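import Summits.QuantumFields.YangMills.Theorems.ForcedResponseSkewnessRunningCouplingCeilingScaleFreeOfMomentBounds
import Summits.QuantumFields.YangMills.Theorems.BalabanLadderInfVolFloorsCore
import HarnessLib

/-!
# Crux `RunningCouplingCeiling` (repaired: stmt-QuantumFields-24275), line «pointwise-log-ceiling-r»: the bounded and the
# GLOBAL scale-free kernel clauses, and `PointwiseSigR` from pair hyperscaling + the log-decay clause

Support file (`--supports stmt-QuantumFields-24275`) by the width prover `ym-line-frs-p3` (g2) of route
`ForcedResponseSkewness` (lead `ym-line-frs-p1`), answering the lead's WAKE targets 1–2 for the registered physics stub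
`stub_pointwise : PointwiseSigR` (`KernelBounds C₀ C₁ C₂ n₀ (a β) L (torusCov β L)` = bounded clause `C₂` + scale-free
clause `C₁` at ALL torus distances `≥ n₀` + running-coupling log clause `C₀` below the unit):

* `abs_torusCov_le`, `torusCov_bound` — the **`C₂` clause is free**: `|torusCov β L x y| ≤ 2·C_dens²` for every `β`, `L`,
  `x`, `y` (bounded action densities, probability of the Wilson measure; the tree's `InfiniteVolume.abs_torusCov_dens_le`).
* `torusCov_eq_torusE_centred`, `abs_torusCov_le_of_pairMoment`, `scaleFree_of_pairMoments` — the **GLOBAL scale-free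
  clause from the explicit pair-moment shape**: if at coupling `β` on the torus of half-side `L` the centred pair moments obey
  `|E[(dens_x − E dens_x)(dens_y − E dens_y)]| ≤ (C/R⁴)²` whenever some cyclic coordinate separation is `≥ 2R+4`, for EVERY
  radius `1 ≤ R`, `4R+8 ≤ L` (the `n = 2` shape of `DlrCollarTransfer.MomentBounds` WITHOUT its locality cap `R·a(β) ≤ ℓ₄`),
  then `d⁸ |torusCov β L x y| ≤ 16⁸ C²` for all `x, y` at torus distance `d ≥ 48` (radius `R = ⌊(m−8)/4⌋` for the sup
  coordinate `m ≤ L`, `d ≤ 2m ≤ 16R`).  Companion of g1's LOCAL version `localScaleFree_of_momentBounds` (p593932), which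
  keeps the cap and concludes only for `a(β)·d ≤ ℓ`.
* `kernelBounds_of_clauses` — the three clauses assemble to `KernelBounds`.
* `pointwiseSigR_of_pairMoments_of_logDecay` — hence **`PointwiseSigR` follows from (i) the eventual GLOBAL pair-moment
  shape (all large `β`, every odd torus, every radius) and (ii) the running-coupling log-decay clause alone**; the `C₂`
  clause is discharged here.  (i) is hyperscaling of the dens–dens covariance at ALL separations, uniformly in the volume —
  an infrared/clustering-class input at distances beyond the correlation length (the registered stub asks for it; the crux
  itself needs only the local clause, see `runningCouplingCeiling_of_localKernelBounds`, p594732); (ii) is the route card's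
  LogCeilingAtPhysicalScale (Bałaban-class, not in print).  Neither is proved here.

Honest label: bookkeeping/reductions inside a CONDITIONAL rung line (leaf R2a `BalabanLadder.NT`, residual 24261 ∋ NT
clause (i)); no stub of 24275 is closed by this file; nothing here bears on the Yang–Mills mass gap, which is NOT proved by
any of this.
-/

set_option autoImplicit false

noncomputable section

namespace Summit.QuantumFields.YangMills.Cruxes.RunningCouplingCeiling.Pointwise

open scoped SchwartzMap
open MeasureTheory Filter Topology Finset
open Literature.MathematicalPhysics.QuantumFieldTheory Literature.MathematicalPhysics.QuantumLattice
open Literature.Probability.LatticeModels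
open Summit.QuantumFields.YangMills.Cruxes.OSLegsFromFemtoAndGap.DlrCollarTransfer
open Summit.QuantumFields.YangMills.Cruxes.NT.CumulantPolarisation (torusE_centred_centred)
open Summit.QuantumFields.YangMills.Theorems.InfiniteVolume (abs_torusCov_dens_le exists_abs_dens_le_uniform)

section Clauses

variable {G : Type} [Group G] [TopologicalSpace G] [IsTopologicalGroup G] [CompactSpace G]
  [MeasurableSpace G] [BorelSpace G] (r : LatticeRep G)

/-! ### The bounded clause `C₂` (free) -/

/-- **The `C₂` clause of `KernelBounds`, explicit constant.**  If `|dens_x| ≤ C` pointwise then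
`|torusCov β L x y| ≤ 2C²` for every coupling, torus and pair of sites. [folklore] -/
theorem abs_torusCov_le {C : ℝ} (hC0 : 0 ≤ C) (hC : ∀ (x : Fin 4 → ℤ) (U : LGConfig 4 G), |dens G r x U| ≤ C)
    (β : ℝ) (L : ℕ) (x y : Fin 4 → ℤ) : |torusCov G r β L x y| ≤ 2 * C ^ 2 := by
  unfold torusCov
  exact abs_torusCov_dens_le r hC0 hC β L x y

/-- **`torusCov_bound` — the `C₂` clause of `KernelBounds` holds unconditionally**: one constant `C₂ = 2·C_dens² ≥ 0`
bounds `|torusCov β L x y|` for all `β`, `L`, `x`, `y` (the action densities are translates of the bounded curvature species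
and the Wilson measure is a probability measure). [folklore] -/
theorem torusCov_bound : ∃ C₂ : ℝ, 0 ≤ C₂ ∧ ∀ (β : ℝ) (L : ℕ) (x y : Fin 4 → ℤ), |torusCov G r β L x y| ≤ C₂ := by
  obtain ⟨C, hC0, hC⟩ := exists_abs_dens_le_uniform r
  exact ⟨2 * C ^ 2, by positivity, abs_torusCov_le r hC0 hC⟩

/-! ### The GLOBAL scale-free clause `C₁` from the pair-moment shape -/

/-- The torus covariance is the expectation of the product of the centred densities. [folklore] -/
theorem torusCov_eq_torusE_centred (β : ℝ) (L : ℕ) (x y : Fin 4 → ℤ) :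
    torusCov G r β L x y = torusE G r β L (fun U =>
      (dens G r x U - torusE G r β L (dens G r x)) * (dens G r y U - torusE G r β L (dens G r y))) := by
  rw [torusE_centred_centred G r β L (continuous_dens r x) (continuous_dens r y)]
  unfold torusCov
  ring

/-- **Pair moment ⇒ covariance.**  If the centred pair moments at cyclic sup-separation `≥ 2R+4` are `≤ (C/R⁴)²`
(coupling `β`, half-side `L`, radius `R`), then so is `|torusCov β L x y|` for every such pair. [folklore] -/
theorem abs_torusCov_le_of_pairMoment (β : ℝ) {C : ℝ} {L R : ℕ}
    (H : ∀ x y : Fin 4 → ℤ,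
      (∃ k : Fin 4, (2 * (R : ℤ) + 4) ≤ |((((x k - y k : ℤ) : ZMod (2 * L + 1))).valMinAbs : ℤ)|) →
      |torusE G r β L (fun U => (dens G r x U - torusE G r β L (dens G r x)) *
          (dens G r y U - torusE G r β L (dens G r y)))| ≤ (C / (R : ℝ) ^ 4) ^ 2)
    (x y : Fin 4 → ℤ)
    (hsep : ∃ k : Fin 4, (2 * (R : ℤ) + 4) ≤ |((((x k - y k : ℤ) : ZMod (2 * L + 1))).valMinAbs : ℤ)|) :
    |torusCov G r β L x y| ≤ (C / (R : ℝ) ^ 4) ^ 2 := by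
  rw [torusCov_eq_torusE_centred]
  exact H x y hsep

/-- **`scaleFree_of_pairMoments` — the GLOBAL scale-free clause from the explicit pair-moment shape.**  At coupling `β` on
the torus of half-side `L`: if for EVERY radius `1 ≤ R` with `4R+8 ≤ L` the centred pair moments of the action densities at
cyclic sup-separation `≥ 2R+4` are `≤ (C/R⁴)²`, then `d⁸ |torusCov β L x y| ≤ 16⁸ C²` for all sites at torus distance
`d ≥ 48` (radius `R = ⌊(m−8)/4⌋ ≥ 4` for the largest cyclic coordinate separation `m ≤ L`; `d ≤ 2m ≤ 16R`). [folklore] -/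
theorem scaleFree_of_pairMoments (β : ℝ) {C : ℝ} {L : ℕ}
    (H : ∀ R : ℕ, 1 ≤ R → 4 * R + 8 ≤ L → ∀ x y : Fin 4 → ℤ,
      (∃ k : Fin 4, (2 * (R : ℤ) + 4) ≤ |((((x k - y k : ℤ) : ZMod (2 * L + 1))).valMinAbs : ℤ)|) →
      |torusE G r β L (fun U => (dens G r x U - torusE G r β L (dens G r x)) *
          (dens G r y U - torusE G r β L (dens G r y)))| ≤ (C / (R : ℝ) ^ 4) ^ 2)
    (x y : Fin 4 → ℤ) (hd : (48 : ℝ) ≤ torusDist L x y) :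
    torusDist L x y ^ 8 * |torusCov G r β L x y| ≤ 16 ^ 8 * C ^ 2 := by
  set d : ℝ := torusDist L x y with hd_def
  obtain ⟨k, _hk, hmL, hdm⟩ := exists_sup_coord L x y
  set m : ℕ := ((x k - y k : ℤ) : ZMod (2 * L + 1)).valMinAbs.natAbs with hm_def
  rw [← hd_def] at hdm
  have hm24 : 24 ≤ m := by
    have : (24 : ℝ) ≤ m := by linarith
    exact_mod_cast this
  set R : ℕ := (m - 8) / 4 with hR_def
  have hR1 : 1 ≤ R := by omega
  have hRm : 4 * R + 8 ≤ m := by omega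
  have hmR : m ≤ 8 * R := by omega
  have hRL : 4 * R + 8 ≤ L := le_trans hRm hmL
  have hsepk : (2 * (R : ℤ) + 4) ≤ |((((x k - y k : ℤ) : ZMod (2 * L + 1))).valMinAbs : ℤ)| := by
    rw [Int.abs_eq_natAbs]
    have : 2 * R + 4 ≤ m := by omega
    exact_mod_cast this
  have hcov := abs_torusCov_le_of_pairMoment r β (H R hR1 hRL) x y ⟨k, hsepk⟩
  have hR0 : (0 : ℝ) < R := by exact_mod_cast hR1
  have hd0 : 0 ≤ d := by rw [hd_def]; unfold torusDist; exact Real.sqrt_nonneg _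
  have hRm' : (m : ℝ) ≤ 8 * (R : ℝ) := by exact_mod_cast hmR
  have h1 : d / R ≤ 16 := by rw [div_le_iff₀ hR0]; linarith
  have h2 : (d / R) ^ 8 ≤ 16 ^ 8 := pow_le_pow_left₀ (div_nonneg hd0 hR0.le) h1 8
  calc d ^ 8 * |torusCov G r β L x y| ≤ d ^ 8 * (C / (R : ℝ) ^ 4) ^ 2 :=
        mul_le_mul_of_nonneg_left hcov (by positivity)
    _ = C ^ 2 * (d / R) ^ 8 := by field_simp
    _ ≤ C ^ 2 * 16 ^ 8 := mul_le_mul_of_nonneg_left h2 (sq_nonneg C)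
    _ = 16 ^ 8 * C ^ 2 := by ring

end Clauses

/-! ### Assembling `KernelBounds` and `PointwiseSigR` -/

/-- **The three clauses assemble to `KernelBounds`** (bounded `C₂`; scale-free `C₁` beyond `n₀`; log decay `C₀` below the
unit). [folklore] -/
theorem kernelBounds_of_clauses {C₀ C₁ C₂ : ℝ} {n₀ : ℕ} {t : ℝ} {L : ℕ} {K : (Fin 4 → ℤ) → (Fin 4 → ℤ) → ℝ}
    (h₂ : ∀ x ∈ box 4 L, ∀ y ∈ box 4 L, |K x y| ≤ C₂)
    (h₁ : ∀ x ∈ box 4 L, ∀ y ∈ box 4 L, (n₀ : ℝ) ≤ torusDist L x y → torusDist L x y ^ 8 * |K x y| ≤ C₁)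
    (h₀ : ∀ x ∈ box 4 L, ∀ y ∈ box 4 L, (n₀ : ℝ) ≤ torusDist L x y → t * torusDist L x y ≤ 1 / 2 →
      torusDist L x y ^ 8 * |K x y| ≤ C₀ / Real.log (1 / (t * torusDist L x y)) ^ 2) :
    KernelBounds C₀ C₁ C₂ n₀ t L K :=
  fun x hx y hy => ⟨h₂ x hx y hy, h₁ x hx y hy, h₀ x hx y hy⟩

/-- **`PointwiseSigR` from GLOBAL pair hyperscaling + the log-decay clause.**  Suppose that for every compact simple `G`,
`r` and unit map `a → 0⁺` carrying the repaired pinning clause (a compactly supported positive-time floor witness):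
(i) for all large `β`, EVERY odd torus `2L+1` and EVERY radius `1 ≤ R`, `4R+8 ≤ L`, the centred pair moments of the action
densities at cyclic sup-separation `≥ 2R+4` are `≤ (C/R⁴)²` (the `n = 2` shape of `MomentBounds` with no locality cap —
hyperscaling of the dens–dens covariance at all separations, uniformly in the volume); and (ii) for all large `β` and tori
`a(β)·L ≥ Λ₀`: `n₀ ≤ d → a(β)·d ≤ ½ → d⁸|torusCov β L x y| ≤ C₀ / log²(1/(a(β) d))` on `box L` (running-coupling decay
below the unit).  Then the registered physics stub `PointwiseSigR` of line «pointwise-log-ceiling-r» holds, with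
`C₁ = 16⁸C²`, `C₂ = 2·C_dens²` (`torusCov_bound`), threshold `max n₀ 48`.  Neither (i) nor (ii) is proved here. [folklore] -/
theorem pointwiseSigR_of_pairMoments_of_logDecay
    (hM : ∀ (G : Type) [Group G] [TopologicalSpace G] [IsTopologicalGroup G] [CompactSpace G],
      IsCompactSimpleLieGroup G →
      letI : MeasurableSpace G := borel G
      haveI : BorelSpace G := ⟨rfl⟩
      ∀ (r : LatticeRep G) (a : ℝ → ℝ), (∀ β, 0 < a β) → Filter.Tendsto a Filter.atTop (nhds 0) →
        (∃ (v₀ : 𝓢(EuclideanSpace ℝ (Fin 4), ℝ)) (ε β₅ Λ₅ : ℝ), HasCompactSupport v₀ ∧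
          tsupport v₀ ⊆ {y : EuclideanSpace ℝ (Fin 4) | 0 < y 0} ∧ 0 < ε ∧
          ∀ β : ℝ, β₅ ≤ β → ∀ L : ℕ, Λ₅ ≤ a β * L → ε ≤ Q2 G r β L (a β) (thetaTest 4 v₀) v₀) →
        ∃ C β₄ : ℝ, ∀ β : ℝ, β₄ ≤ β → ∀ (L R : ℕ), 1 ≤ R → 4 * R + 8 ≤ L → ∀ x y : Fin 4 → ℤ,
          (∃ k : Fin 4, (2 * (R : ℤ) + 4) ≤ |((((x k - y k : ℤ) : ZMod (2 * L + 1))).valMinAbs : ℤ)|) →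
          |torusE G r β L (fun U => (dens G r x U - torusE G r β L (dens G r x)) *
              (dens G r y U - torusE G r β L (dens G r y)))| ≤ (C / (R : ℝ) ^ 4) ^ 2)
    (hlog : ∀ (G : Type) [Group G] [TopologicalSpace G] [IsTopologicalGroup G] [CompactSpace G],
      IsCompactSimpleLieGroup G →
      letI : MeasurableSpace G := borel G
      haveI : BorelSpace G := ⟨rfl⟩
      ∀ (r : LatticeRep G) (a : ℝ → ℝ), (∀ β, 0 < a β) → Filter.Tendsto a Filter.atTop (nhds 0) →
        (∃ (v₀ : 𝓢(EuclideanSpace ℝ (Fin 4), ℝ)) (ε β₅ Λ₅ : ℝ), HasCompactSupport v₀ ∧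
          tsupport v₀ ⊆ {y : EuclideanSpace ℝ (Fin 4) | 0 < y 0} ∧ 0 < ε ∧
          ∀ β : ℝ, β₅ ≤ β → ∀ L : ℕ, Λ₅ ≤ a β * L → ε ≤ Q2 G r β L (a β) (thetaTest 4 v₀) v₀) →
        ∃ C₀ : ℝ, ∃ n₀ : ℕ, ∃ β₀ Λ₀ : ℝ, ∀ β : ℝ, β₀ ≤ β → ∀ L : ℕ, Λ₀ ≤ a β * L →
          ∀ x ∈ box 4 L, ∀ y ∈ box 4 L,
            (n₀ : ℝ) ≤ torusDist L x y → a β * torusDist L x y ≤ 1 / 2 →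
              torusDist L x y ^ 8 * |torusCov G r β L x y| ≤
                C₀ / Real.log (1 / (a β * torusDist L x y)) ^ 2) :
    PointwiseSigR := by
  intro G _ _ _ _ hG
  letI : MeasurableSpace G := borel G
  haveI : BorelSpace G := ⟨rfl⟩
  intro r a hapos hlim hpin
  obtain ⟨C, β₄, hC⟩ := hM G hG r a hapos hlim hpin
  obtain ⟨C₀, n₀, β₀, Λ₀, h₀⟩ := hlog G hG r a hapos hlim hpin
  obtain ⟨C₂, -, hC₂⟩ := torusCov_bound r
  refine ⟨C₀, 16 ^ 8 * C ^ 2, C₂, max n₀ 48, max β₄ β₀, Λ₀, fun β hβ L hL => ?_⟩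
  refine kernelBounds_of_clauses (fun x _ y _ => hC₂ β L x y) (fun x _ y _ hd => ?_)
    (fun x hx y hy hd htd => ?_)
  · have h48 : (48 : ℝ) ≤ torusDist L x y :=
      le_trans (by exact_mod_cast le_max_right n₀ 48) hd
    exact scaleFree_of_pairMoments r β
      (fun R hR hRL => hC β (le_trans (le_max_left _ _) hβ) L R hR hRL) x y h48
  · have hn : (n₀ : ℝ) ≤ torusDist L x y :=
      le_trans (by exact_mod_cast le_max_left n₀ 48) hd
    exact h₀ β (le_trans (le_max_right _ _) hβ) L hL x hx y hy hn htd

end Summit.QuantumFields.YangMills.Cruxes.RunningCouplingCeiling.Pointwise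

end
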